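import Summits.CriticalPhenomena.CardyFormulaZ2.Theorems.HalfPlaneMarkDensityLaw.Negative.MarkEvents

/-!
# `HalfPlaneMarkDensityLaw` (crux stmt-CriticalPhenomena-5661), line `Sketch`, cycle 3 (DensePos):
# stubs P1, P1' — a strictly increasing differentiable function has positive derivative densely

Pure real analysis (mean value theorem).  Let `s` be an open set of reals, `f` strictly increasing
and differentiable on `s`, and `x₀ ∈ s`.  If no point of some neighbourhood `t` of `x₀` had
`x ∈ s ∧ 0 < deriv f x`, then on a small interval `(x₀ - ε, x₀ + ε) ⊆ t ∩ s` we would have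
`deriv f ≤ 0`, so `f` would be antitone there (`antitoneOn_of_deriv_nonpos`), contradicting strict
monotonicity at the two points `x₀ - ε/2 < x₀`.  Hence `s ⊆ closure {x ∈ s | 0 < deriv f x}`;
the registered stubs are the cases `s = Ioi u` (P1) and `s = Ioo u v` (P1').
-/

noncomputable section

namespace Summit.CriticalPhenomena.CardyFormulaZ2.Cruxes.HalfPlaneMarkDensityLaw.SketchLine

open Literature.Probability.Percolation Literature.Probability.LatticeModels
open MeasureTheory Filter Set
open scoped Topology
open Summit.CriticalPhenomena.CardyFormulaZ2.Theorems.HalfPlaneMarkDensityLaw.Negative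

namespace DensePos

/-- On an open set `s`, a strictly increasing function differentiable on `s` has positive derivative
on a dense subset of `s`: `s ⊆ closure {x ∈ s | 0 < f' x}`. [folklore] -/
private theorem subset_closure_deriv_pos {f : ℝ → ℝ} {s : Set ℝ} (hs : IsOpen s)
    (hmono : StrictMonoOn f s) (hdiff : DifferentiableOn ℝ f s) :
    s ⊆ closure {x | x ∈ s ∧ 0 < deriv f x} := by
  intro x₀ hx₀
  rw [mem_closure_iff_nhds]
  intro t ht
  by_contra hcon
  obtain ⟨ε, hε, hball⟩ := Metric.mem_nhds_iff.1 (inter_mem ht (hs.mem_nhds hx₀))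
  rw [Real.ball_eq_Ioo] at hball
  -- on the interval `(x₀ - ε, x₀ + ε) ⊆ t ∩ s` the derivative is nonpositive
  have hderiv : ∀ x ∈ interior (Ioo (x₀ - ε) (x₀ + ε)), deriv f x ≤ 0 := by
    intro x hx
    rw [interior_Ioo] at hx
    by_contra h
    exact hcon ⟨x, (hball hx).1, (hball hx).2, not_le.1 h⟩
  have hdiff' : DifferentiableOn ℝ f (Ioo (x₀ - ε) (x₀ + ε)) :=
    hdiff.mono fun x hx ↦ (hball hx).2
  have hanti : AntitoneOn f (Ioo (x₀ - ε) (x₀ + ε)) :=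
    antitoneOn_of_deriv_nonpos (convex_Ioo _ _) hdiff'.continuousOn
      (hdiff'.mono interior_subset) hderiv
  have h1 : x₀ - ε / 2 ∈ Ioo (x₀ - ε) (x₀ + ε) := ⟨by linarith, by linarith⟩
  have h2 : x₀ ∈ Ioo (x₀ - ε) (x₀ + ε) := ⟨by linarith, by linarith⟩
  have hlt : f (x₀ - ε / 2) < f x₀ := hmono (hball h1).2 hx₀ (by linarith)
  have hle : f x₀ ≤ f (x₀ - ε / 2) := hanti h1 h2 (by linarith)
  exact absurd hle (not_le.2 hlt)

/-- STUB P1 (real analysis): a strictly increasing function differentiable on `(u,∞)` has positive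
derivative on a dense subset of `(u,∞)`. [folklore] -/
theorem stub_deriv_pos_dense :
    ∀ (f : ℝ → ℝ) (u : ℝ), StrictMonoOn f (Ioi u) → DifferentiableOn ℝ f (Ioi u) →
      Ioi u ⊆ closure {x | u < x ∧ 0 < deriv f x} := by
  intro f u hmono hdiff
  have h := subset_closure_deriv_pos isOpen_Ioi hmono hdiff
  have hset : {x | x ∈ Ioi u ∧ 0 < deriv f x} = {x | u < x ∧ 0 < deriv f x} := by
    ext x
    simp only [mem_setOf_eq, mem_Ioi]
  rwa [hset] at h

/-- STUB P1' (real analysis, bounded interval): a strictly increasing function differentiable on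
`(u,v)` has positive derivative on a dense subset of `(u,v)`. [folklore] -/
theorem stub_deriv_pos_dense_Ioo :
    ∀ (f : ℝ → ℝ) (u v : ℝ), StrictMonoOn f (Ioo u v) → DifferentiableOn ℝ f (Ioo u v) →
      Ioo u v ⊆ closure {x | u < x ∧ x < v ∧ 0 < deriv f x} := by
  intro f u v hmono hdiff
  have h := subset_closure_deriv_pos isOpen_Ioo hmono hdiff
  have hset : {x | x ∈ Ioo u v ∧ 0 < deriv f x} = {x | u < x ∧ x < v ∧ 0 < deriv f x} := by
    ext x
    simp only [mem_setOf_eq, mem_Ioo, and_assoc]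
  rwa [hset] at h

end DensePos

end Summit.CriticalPhenomena.CardyFormulaZ2.Cruxes.HalfPlaneMarkDensityLaw.SketchLine
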